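import Mathlib
import Summits.Ventures.PercRepro.TriangleCapSubBandOne

/-!
# PercRepro — THE SUB-BAND BOUND: EVERY SUB-BAND `u` FROM ABOVE BY ONE TANGENT LINE (p3, gen 52; part 257)

At the band value `2 j` of a vertex `w` with `t` off-edges, a non-neighbour `x` of `w` with `offDeg H w x = t − u`
(`1 ≤ t − u`) and `ℓ` non-neighbours of `w` in all satisfy, for EVERY `q ≥ 1`,

  **`2 j + 2 q u ≤ 2 u (t − u − 1) + u (u + 1) + (ℓ − 1) q (q + 1)`**  (`subband_upper_bound`).

With the lower bound `u (t − u − 1) ≤ j` (part 252) this is the whole sub-band structure of the band on `n` vertices: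
the sub-band `u` lies in `[u (t − u − 1), u (t − u − 1) + W]`, `W = min_q [u (u + 1) − 2 q u + (ℓ − 1) q (q + 1)] / 2`
— the row-band formula of part 240 with `u` pairs over the `ℓ − 1` non-neighbours other than `x`.  THE PROOF is one
double count and one tangent line: `2 j = t (t − 1) + 2 |inside| − offAdjPairs`; `offAdjPairs ≥ (t − u)(t − u − 1)
+ Σ_{L′} c (c − 1)` over the non-neighbours `L′` other than `x`; `Σ_{L′} c ≥ |inside| + u` (an inside edge has an end
in `L′`, an off-edge of `x` has an end in `L′`, an inside off-edge of `x` both); and the tangent line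
`2 q c ≤ c (c − 1) + q (q + 1)` (part 236) summed over `L′`.  At `u = 1, q = 1` this is part 255's `j ≤ t + ℓ − 3`
without its case analysis; at `u = 2, q = 1`: `j ≤ 2 t − 6 + ℓ`; at `u = 3, q = 2, ℓ = 2`: `j ≤ 3 t − 9`.
Axioms: standard.
-/

namespace PercRepro

namespace TriangleCap

namespace C047

open Finset

variable {V : Type*} [Fintype V] [DecidableEq V]

/-- An off-edge `e = s(p, q)` has at least `[e inside] + [x ∉ e]` ends among the non-neighbours other than the
non-neighbour `x`. -/
theorem card_ends_nonNbrs_ge (H : SimpleGraph V) [DecidableRel H.Adj] (hfree : H.CliqueFree 3) (w x : V)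
    (e : Sym2 V) (he : e ∈ offEdges H w) :
    (if e ∈ insideEdges H w then 1 else 0) + (if x ∈ e then 0 else 1) ≤
      (((nonNbrs H w).erase x).filter (fun v => v ∈ e)).card := by
  revert he
  induction e using Sym2.ind with
  | _ p q =>
  intro he
  have hpw : p ≠ w := fun h => notMem_of_mem_offEdges H w he (h ▸ Sym2.mem_mk_left p q)
  have hqw : q ≠ w := fun h => notMem_of_mem_offEdges H w he (h ▸ Sym2.mem_mk_right p q)
  have hpq : H.Adj p q := (mem_offEdges_iff_adj H w p q hpw hqw).mp he
  have hmem : ∀ v, v ∈ s(p, q) → ¬ H.Adj w v → v ≠ x →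
      v ∈ ((nonNbrs H w).erase x).filter (fun v => v ∈ s(p, q)) := by
    intro v hv hwv hvx
    rw [mem_filter, mem_erase, mem_nonNbrs]
    refine ⟨⟨hvx, ?_, hwv⟩, hv⟩
    rw [Sym2.mem_iff] at hv
    rcases hv with rfl | rfl
    · exact hpw
    · exact hqw
  by_cases hin : s(p, q) ∈ insideEdges H w
  · rw [if_pos hin]
    have hin' := (mem_insideEdges H w _).mp hin
    have hwp : ¬ H.Adj w p := hin'.2 p (Sym2.mem_mk_left p q)
    have hwq : ¬ H.Adj w q := hin'.2 q (Sym2.mem_mk_right p q)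
    by_cases hx : x ∈ s(p, q)
    · rw [if_pos hx]
      rw [Sym2.mem_iff] at hx
      rcases hx with rfl | rfl
      · exact card_pos.mpr ⟨q, hmem q (Sym2.mem_mk_right _ q) hwq hpq.ne.symm⟩
      · exact card_pos.mpr ⟨p, hmem p (Sym2.mem_mk_left p _) hwp hpq.ne⟩
    · rw [if_neg hx]
      rw [Sym2.mem_iff, not_or] at hx
      exact one_lt_card.mpr ⟨p, hmem p (Sym2.mem_mk_left p q) hwp (fun h => hx.1 h.symm), q,
        hmem q (Sym2.mem_mk_right p q) hwq (fun h => hx.2 h.symm), hpq.ne⟩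
  · rw [if_neg hin]
    by_cases hx : x ∈ s(p, q)
    · rw [if_pos hx]
      exact Nat.zero_le _
    · rw [if_neg hx]
      rw [Sym2.mem_iff, not_or] at hx
      have hnot : ∃ v, v ∈ s(p, q) ∧ H.Adj w v := by
        by_contra hcon
        apply hin
        rw [mem_insideEdges]
        exact ⟨he, fun v hv hwv => hcon ⟨v, hv, hwv⟩⟩
      obtain ⟨v, hv, hwv⟩ := hnot
      rw [Sym2.mem_iff] at hv
      rcases hv with rfl | rfl
      · have hwq : ¬ H.Adj w q := not_adj_of_adj_adj H hfree hwv.symm hpq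
        exact card_pos.mpr ⟨q, hmem q (Sym2.mem_mk_right v q) hwq (fun h => hx.2 h.symm)⟩
      · have hwp : ¬ H.Adj w p := not_adj_of_adj_adj H hfree hwv.symm hpq.symm
        exact card_pos.mpr ⟨p, hmem p (Sym2.mem_mk_left p v) hwp (fun h => hx.1 h.symm)⟩

/-- **THE DOUBLE COUNT:** `Σ_{L′} offDeg ≥ |inside| + #{e ∈ F : x ∉ e}` over the non-neighbours `L′` other than
the non-neighbour `x`. -/
theorem sum_offDeg_erase_ge (H : SimpleGraph V) [DecidableRel H.Adj] (hfree : H.CliqueFree 3) (w x : V) :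
    (insideEdges H w).card + ((offEdges H w).filter (fun e => x ∉ e)).card ≤
      ∑ v ∈ (nonNbrs H w).erase x, offDeg H w v := by
  have h1 : (insideEdges H w).card = ∑ e ∈ offEdges H w, if e ∈ insideEdges H w then 1 else 0 := by
    rw [← sum_filter, card_eq_sum_ones]
    apply sum_congr
    · ext e
      simp only [mem_filter]
      constructor
      · intro h
        exact ⟨((mem_insideEdges H w e).mp h).1, h⟩
      · intro h
        exact h.2
    · intros
      rfl
  rw [h1, card_filter, ← sum_add_distrib]
  unfold offDeg
  simp_rw [card_filter]
  rw [sum_comm]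
  apply sum_le_sum
  intro e he
  have := card_ends_nonNbrs_ge H hfree w x e he
  rw [card_filter] at this
  have e2 : (if x ∉ e then 1 else 0) = (if x ∈ e then 0 else 1) := by
    by_cases hx : x ∈ e
    · rw [if_neg (not_not.mpr hx), if_pos hx]
    · rw [if_pos hx, if_neg hx]
  rw [e2]
  exact this

omit [Fintype V] [DecidableEq V] in
/-- The tangent line summed over a set: `2 q Σ_L c ≤ Σ_L c (c − 1) + |L| q (q + 1)`. -/
theorem two_mul_sum_le (L : Finset V) (c : V → ℕ) (q : ℕ) :
    2 * (q * ∑ v ∈ L, c v) ≤ ∑ v ∈ L, c v * (c v - 1) + L.card * (q * (q + 1)) := by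
  rw [mul_sum, mul_sum, card_eq_sum_ones, sum_mul, ← sum_add_distrib]
  apply sum_le_sum
  intro v _
  have := two_mul_le_mul_pred_add (c v) q
  rw [one_mul]
  calc 2 * (q * c v) = 2 * q * c v := by ring
    _ ≤ c v * (c v - 1) + q * (q + 1) := this

/-- `offAdjPairs ≥ c(x)(c(x) − 1) + Σ_{L′} c (c − 1)` for `x ∉ L′ ∌ w`, `x ≠ w`. -/
theorem offAdjPairs_ge_insert (H : SimpleGraph V) [DecidableRel H.Adj] (w x : V) (L : Finset V) (hxw : x ≠ w)
    (hwL : w ∉ L) (hxL : x ∉ L) :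
    offDeg H w x * (offDeg H w x - 1) + ∑ v ∈ L, offDeg H w v * (offDeg H w v - 1) ≤ offAdjPairs H w := by
  have := sum_offDeg_mul_pred_le H w (insert x L) (by
    rw [mem_insert, not_or]
    exact ⟨fun h => hxw h.symm, hwL⟩)
  rw [sum_insert hxL] at this
  exact this

/-- The identity behind the sub-band bound: `t (t − 1) = (t − u)(t − u − 1) + 2 u (t − u − 1) + u (u + 1)` for
`u + 1 ≤ t`. -/
theorem subband_identity (t u : ℕ) (hu : u + 1 ≤ t) :
    t * (t - 1) = (t - u) * (t - u - 1) + 2 * (u * (t - u - 1)) + u * (u + 1) := by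
  obtain ⟨d, rfl⟩ : ∃ d, t = u + 1 + d := ⟨t - u - 1, by omega⟩
  have e1 : u + 1 + d - 1 = u + d := by omega
  have e2 : u + 1 + d - u = d + 1 := by omega
  have e3 : u + 1 + d - u - 1 = d := by omega
  rw [e3, e2, e1]
  ring

/-- **THE SUB-BAND BOUND:** at the band value `2 j`, a non-neighbour `x` of `w` with `offDeg H w x + u = t`,
`1 ≤ t − u`, satisfies for every `q ≥ 1`:
`2 j + 2 q u ≤ 2 u (t − u − 1) + u (u + 1) + (|nonNbrs| − 1) q (q + 1)`. -/
theorem subband_upper_bound (H : SimpleGraph V) [DecidableRel H.Adj] (hfree : H.CliqueFree 3) (s t u j : ℕ)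
    (hs : H.edgeFinset.card = s) (w : V) (hw : 1 ≤ deg H w) (ht : (offEdges H w).card = t)
    (hj : ∑ v, deg H v * deg H v + 2 * (t * (s - t - 1)) + 2 * j = s * (s + 1)) (x : V)
    (hx : offDeg H w x + u = t) (hxw : ¬ H.Adj w x) (hu : u + 1 ≤ t) (q : ℕ) (hq : 1 ≤ q) :
    2 * j + 2 * (q * u) ≤ 2 * (u * (t - u - 1)) + u * (u + 1) + ((nonNbrs H w).card - 1) * (q * (q + 1)) := by
  have hxw' : x ≠ w := by
    intro h
    rw [h, offDeg_self] at hx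
    omega
  have hxmem : x ∈ nonNbrs H w := (mem_nonNbrs H w x).mpr ⟨hxw', hxw⟩
  have hval := (layer_value_iff H s t j hs w hw ht).mp hj
  have hatt := attach_add_card_inside H hfree w
  rw [ht] at hatt
  -- the off-edges of `x` number `u`
  have hu' : ((offEdges H w).filter (fun e => x ∉ e)).card = u := by
    have := card_filter_add_card_filter_not (s := offEdges H w) (fun e => x ∈ e)
    unfold offDeg at hx
    omega
  set L := (nonNbrs H w).erase x with hL
  have hcardL : L.card = (nonNbrs H w).card - 1 := by rw [hL, card_erase_of_mem hxmem]
  have hwL : w ∉ L := by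
    rw [hL, mem_erase, mem_nonNbrs]
    intro h
    exact h.2.1 rfl
  have hxL : x ∉ L := by
    rw [hL, mem_erase]
    intro h
    exact h.1 rfl
  have hsum := sum_offDeg_erase_ge H hfree w x
  rw [hu', ← hL] at hsum
  have htan := two_mul_sum_le L (offDeg H w) q
  rw [hcardL] at htan
  have hP := offAdjPairs_ge_insert H w x L hxw' hwL hxL
  have hcx : offDeg H w x * (offDeg H w x - 1) = (t - u) * (t - u - 1) := by
    have : offDeg H w x = t - u := by omega
    rw [this]
  rw [hcx] at hP
  have hid := subband_identity t u hu
  have e3 : t * (t + 1) = t * (t - 1) + 2 * t := by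
    rcases t with _ | t
    · simp
    · rw [Nat.add_sub_cancel]
      ring
  -- the monotone steps: `q * Σ ≥ q * (|inside| + u) ≥ |inside| + q * u`
  have hmono : q * ((insideEdges H w).card + u) ≤ q * ∑ v ∈ L, offDeg H w v := Nat.mul_le_mul_left q hsum
  have hdistr : q * ((insideEdges H w).card + u) = q * (insideEdges H w).card + q * u := by ring
  have hqI : (insideEdges H w).card ≤ q * (insideEdges H w).card := Nat.le_mul_of_pos_left _ hq
  omega

/-- **THE SUB-BAND BOUND ON `n` VERTICES:** on `ℓ + 1 + (s − t)` vertices, at the band value `2 j` of a vertex `w`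
of degree `s − t ≥ 1`, a non-neighbour `x` of `w` with `offDeg H w x + u = t` (`u + 1 ≤ t`) gives, for every
`q ≥ 1`, `2 j + 2 q u ≤ 2 u (t − u − 1) + u (u + 1) + (ℓ − 1) q (q + 1)`. -/
theorem subband_upper_bound_vertices (ℓ s t : ℕ) (H : SimpleGraph (Fin (ℓ + 1 + (s - t)))) [DecidableRel H.Adj]
    (hfree : H.CliqueFree 3) (hs : H.edgeFinset.card = s) (w : Fin (ℓ + 1 + (s - t))) (hw : deg H w + t = s)
    (hw1 : 1 ≤ deg H w) (u j : ℕ)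
    (hj : ∑ v, deg H v * deg H v + 2 * (t * (s - t - 1)) + 2 * j = s * (s + 1)) (x : Fin (ℓ + 1 + (s - t)))
    (hx : offDeg H w x + u = t) (hxw : ¬ H.Adj w x) (hu : u + 1 ≤ t) (q : ℕ) (hq : 1 ≤ q) :
    2 * j + 2 * (q * u) ≤ 2 * (u * (t - u - 1)) + u * (u + 1) + (ℓ - 1) * (q * (q + 1)) := by
  have hc := card_nonNbrs_add H w
  rw [Fintype.card_fin] at hc
  have hcard := card_offEdges_add_deg H w
  have := subband_upper_bound H hfree s t u j hs w hw1 (by omega) hj x hx hxw hu q hq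
  have hℓ : (nonNbrs H w).card = ℓ := by omega
  rw [hℓ] at this
  exact this

/-- **THE SUB-BAND `u = 2` FROM ABOVE:** `j ≤ 2 t − 6 + ℓ` (`q = 1`). -/
theorem subband_two_upper (ℓ s t : ℕ) (H : SimpleGraph (Fin (ℓ + 1 + (s - t)))) [DecidableRel H.Adj]
    (hfree : H.CliqueFree 3) (hs : H.edgeFinset.card = s) (w : Fin (ℓ + 1 + (s - t))) (hw : deg H w + t = s)
    (hw1 : 1 ≤ deg H w) (j : ℕ)
    (hj : ∑ v, deg H v * deg H v + 2 * (t * (s - t - 1)) + 2 * j = s * (s + 1)) (x : Fin (ℓ + 1 + (s - t)))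
    (hx : offDeg H w x + 2 = t) (hxw : ¬ H.Adj w x) (hℓ : 1 ≤ ℓ) (ht : 3 ≤ t) : j + 6 ≤ 2 * t + ℓ := by
  have := subband_upper_bound_vertices ℓ s t H hfree hs w hw hw1 2 j hj x hx hxw (by omega) 1 le_rfl
  obtain ⟨t', rfl⟩ : ∃ t', t = t' + 3 := ⟨t - 3, by omega⟩
  obtain ⟨l', rfl⟩ : ∃ l', ℓ = l' + 1 := ⟨ℓ - 1, by omega⟩
  norm_num at this
  omega

/-- With at least one off-edge, some non-neighbour of `w` carries an off-edge (an off-edge has an end off `N(w)`). -/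
theorem exists_nonNbr_offDeg_pos (H : SimpleGraph V) [DecidableRel H.Adj] (hfree : H.CliqueFree 3) (w : V)
    (ht : 1 ≤ (offEdges H w).card) : ∃ x ∈ nonNbrs H w, 1 ≤ offDeg H w x := by
  obtain ⟨e, he⟩ := card_pos.mp (by omega : 0 < (offEdges H w).card)
  have hne := mem_edgeFinset_of_mem_offEdges H w he
  have hone := card_adj_mem_le_one H hfree w e hne
  revert he hne hone
  induction e using Sym2.ind with
  | _ p q =>
  intro he hne hone
  have hpw : p ≠ w := fun h => notMem_of_mem_offEdges H w he (h ▸ Sym2.mem_mk_left p q)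
  have hqw : q ≠ w := fun h => notMem_of_mem_offEdges H w he (h ▸ Sym2.mem_mk_right p q)
  have hpq : H.Adj p q := (mem_offEdges_iff_adj H w p q hpw hqw).mp he
  have hmem : ∀ v, v ∈ s(p, q) → 1 ≤ offDeg H w v := by
    intro v hv
    unfold offDeg
    exact card_pos.mpr ⟨s(p, q), mem_filter.mpr ⟨he, hv⟩⟩
  by_cases hwp : H.Adj w p
  · have hwq : ¬ H.Adj w q := not_adj_of_adj_adj H hfree hwp.symm hpq
    exact ⟨q, (mem_nonNbrs H w q).mpr ⟨hqw, hwq⟩, hmem q (Sym2.mem_mk_right p q)⟩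
  · exact ⟨p, (mem_nonNbrs H w p).mpr ⟨hpw, hwp⟩, hmem p (Sym2.mem_mk_left p q)⟩

/-- **THE SUB-BAND MEMBERSHIP THEOREM:** every band value `2 j` of a vertex `w` with `t ≥ 1` off-edges lies in a
sub-band: for some `u + 1 ≤ t`, `u (t − u − 1) ≤ j` and, for every `q ≥ 1`,
`2 j + 2 q u ≤ 2 u (t − u − 1) + u (u + 1) + (|nonNbrs| − 1) q (q + 1)`. -/
theorem subband_membership (H : SimpleGraph V) [DecidableRel H.Adj] (hfree : H.CliqueFree 3) (s t j : ℕ)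
    (hs : H.edgeFinset.card = s) (w : V) (hw : 1 ≤ deg H w) (ht : (offEdges H w).card = t)
    (hj : ∑ v, deg H v * deg H v + 2 * (t * (s - t - 1)) + 2 * j = s * (s + 1)) (ht1 : 1 ≤ t) :
    ∃ u, u + 1 ≤ t ∧ u * (t - u - 1) ≤ j ∧ ∀ q, 1 ≤ q →
      2 * j + 2 * (q * u) ≤ 2 * (u * (t - u - 1)) + u * (u + 1) + ((nonNbrs H w).card - 1) * (q * (q + 1)) := by
  obtain ⟨x, hx, hx1⟩ := exists_nonNbr_offDeg_pos H hfree w (by omega)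
  have hxw : ¬ H.Adj w x := ((mem_nonNbrs H w x).mp hx).2
  have hle := offDeg_le_card H w x
  rw [ht] at hle
  refine ⟨t - offDeg H w x, by omega, subband_lower_bound H hfree s t _ j hs w hw ht hj x (by omega),
    fun q hq => subband_upper_bound H hfree s t _ j hs w hw ht hj x (by omega) hxw (by omega) q hq⟩

/-- **THE SUB-BAND MEMBERSHIP THEOREM ON `n` VERTICES:** on `ℓ + 1 + (s − t)` vertices every band value `2 j` of a
vertex of degree `s − t ≥ 1` with `t ≥ 1` lies in a sub-band `u`: `u (t − u − 1) ≤ j` and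
`2 j + 2 q u ≤ 2 u (t − u − 1) + u (u + 1) + (ℓ − 1) q (q + 1)` for every `q ≥ 1`. -/
theorem subband_membership_vertices (ℓ s t : ℕ) (H : SimpleGraph (Fin (ℓ + 1 + (s - t)))) [DecidableRel H.Adj]
    (hfree : H.CliqueFree 3) (hs : H.edgeFinset.card = s) (w : Fin (ℓ + 1 + (s - t))) (hw : deg H w + t = s)
    (hw1 : 1 ≤ deg H w) (ht1 : 1 ≤ t) (j : ℕ)
    (hj : ∑ v, deg H v * deg H v + 2 * (t * (s - t - 1)) + 2 * j = s * (s + 1)) :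
    ∃ u, u + 1 ≤ t ∧ u * (t - u - 1) ≤ j ∧ ∀ q, 1 ≤ q →
      2 * j + 2 * (q * u) ≤ 2 * (u * (t - u - 1)) + u * (u + 1) + (ℓ - 1) * (q * (q + 1)) := by
  have hc := card_nonNbrs_add H w
  rw [Fintype.card_fin] at hc
  have hcard := card_offEdges_add_deg H w
  have hℓ : (nonNbrs H w).card = ℓ := by omega
  have := subband_membership H hfree s t j hs w hw1 (by omega) hj ht1
  rw [hℓ] at this
  exact this

end C047

end TriangleCap

end PercRepro
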